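import Mathlib.Analysis.Complex.Trigonometric
import Mathlib.Data.Complex.BigOperators
import Mathlib.Algebra.BigOperators.Ring.Finset
import Summits.AtomisticToContinuum.BoseEinsteinCondensation.Theorems.BECInfDivCoherenceGridAverageCondensateFourier
import HarnessLib

/-!
# Route `BECInfDivCoherence`, crux `GridInfDivCoherence` (stmt-AtomisticToContinuum-9114) —
# support lemma: orthogonality of the non-trivial characters of `(ℤ/m)³`, real coordinate form

`stub_gridCharacterSum`: for `m : ℕ` and a frequency `q : Fin 3 → Fin m` with some coordinate
`(q k : ℕ) ≠ 0`, the real character sum over the `m³`-point grid vanishes,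
`Σ_{j : Fin 3 → Fin m} cos(2π (Σ_k q_k j_k)/m) = 0`.

This is the pure stub of the same name in the birth skeleton of the crux (line "coherence is
infinitely divisible" + dual-side Schoenberg limit): it supplies `Σ_j c_j = 0` for the weights
`c_j = cos(2π q·j/m)` fed to the Schoenberg limit `t → 0⁺`, so that the constant term of the
Hadamard powers `G^t = 1 + t log G + O(t²)` drops out at every frequency `q ≢ 0`.

Proof: `cos θ = Re e^{iθ}` (`Complex.exp_ofReal_mul_I_re`); the exponential of the sum over the
three coordinates factorises (`Complex.exp_sum`), and `Fintype.prod_sum` turns the grid sum of the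
product character into the product of the three one-dimensional character sums
`Σ_{t < m} e^{2πi q_k t/m}`, each evaluated by the tree lemma
`BECInfDivCoherenceGridAverage.sum_exp_two_pi_div` (`= m` if `m ∣ q_k`, else `0`); the factor at a
coordinate with `0 < q_k < m` vanishes, hence so does the product and its real part.

Folklore (orthogonality of the characters of a finite abelian group, e.g. Berg–Forst 1975, Ch. I).
Deliberately not here: the complementary case `q ≡ 0` (the sum is then `m³`), and anything about
the coherence function itself.
-/

namespace Summit.AtomisticToContinuum.BoseEinsteinCondensation.Theorems

open BECInfDivCoherenceGridAverage (sum_exp_two_pi_div)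

/-- **Orthogonality of the non-trivial characters of `(ℤ/m)³`, real coordinate form.** For
`m : ℕ` and `q : Fin 3 → Fin m` with some coordinate `(q k : ℕ) ≠ 0`,
`Σ_{j : Fin 3 → Fin m} cos(2π (Σ_k q_k j_k)/m) = 0`: the sum is the real part of
`Π_k Σ_{t < m} exp(2πi q_k t/m)`, whose factor at a coordinate with `0 < q_k < m` is a vanishing
sum of `m`-th roots of unity (`sum_exp_two_pi_div`). (For `m = 0` the type `Fin 3 → Fin 0` is
empty and the hypothesis is vacuous.) [folklore] -/
theorem stub_gridCharacterSum :
    ∀ (m : ℕ) (q : Fin 3 → Fin m), (∃ k, (q k : ℕ) ≠ 0) →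
      ∑ j : Fin 3 → Fin m,
        Real.cos (2 * Real.pi * (∑ k, ((q k : ℕ) : ℝ) * ((j k : ℕ) : ℝ)) / m) = 0 := by
  intro m q hq
  obtain ⟨k₀, hk₀⟩ := hq
  have hm : 0 < m := by
    rcases Nat.eq_zero_or_pos m with h | h
    · subst h
      exact (q k₀).elim0
    · exact h
  -- each cosine is the real part of the product of the three one-dimensional characters
  have hcos : ∀ j : Fin 3 → Fin m,
      Real.cos (2 * Real.pi * (∑ k, ((q k : ℕ) : ℝ) * ((j k : ℕ) : ℝ)) / m) =
        (∏ k : Fin 3, Complex.exp (2 * Real.pi * Complex.I * (((q k : ℕ) : ℤ) : ℂ) *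
          (((j k : Fin m) : ℕ) : ℂ) / m)).re := by
    intro j
    have harg : (((2 * Real.pi * (∑ k, ((q k : ℕ) : ℝ) * ((j k : ℕ) : ℝ)) / m : ℝ)) : ℂ) *
        Complex.I = ∑ k : Fin 3,
          2 * Real.pi * Complex.I * (((q k : ℕ) : ℤ) : ℂ) * (((j k : Fin m) : ℕ) : ℂ) / m := by
      push_cast
      simp only [Finset.mul_sum, Finset.sum_div, Finset.sum_mul]
      exact Finset.sum_congr rfl fun k _ => by ring
    rw [← Complex.exp_ofReal_mul_I_re, harg, Complex.exp_sum]
  -- the coordinate `k₀` with `0 < q k₀ < m` is not divisible by `m`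
  have hndvd : ¬ (m : ℤ) ∣ ((q k₀ : ℕ) : ℤ) := by
    rw [Int.natCast_dvd_natCast]
    exact fun h => hk₀ (Nat.eq_zero_of_dvd_of_lt h (q k₀).isLt)
  -- so the `k₀`-th one-dimensional character sum vanishes, and with it the product
  have hprod : ∏ k : Fin 3, ∑ t : Fin m,
      Complex.exp (2 * Real.pi * Complex.I * (((q k : ℕ) : ℤ) : ℂ) * ((t : ℕ) : ℂ) / m) = 0 := by
    apply Finset.prod_eq_zero (Finset.mem_univ k₀)
    rw [sum_exp_two_pi_div m hm, if_neg hndvd]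
  calc ∑ j : Fin 3 → Fin m,
        Real.cos (2 * Real.pi * (∑ k, ((q k : ℕ) : ℝ) * ((j k : ℕ) : ℝ)) / m)
      = ∑ j : Fin 3 → Fin m, (∏ k : Fin 3, Complex.exp (2 * Real.pi * Complex.I *
          (((q k : ℕ) : ℤ) : ℂ) * (((j k : Fin m) : ℕ) : ℂ) / m)).re :=
        Finset.sum_congr rfl fun j _ => hcos j
    _ = (∑ j : Fin 3 → Fin m, ∏ k : Fin 3, Complex.exp (2 * Real.pi * Complex.I *
          (((q k : ℕ) : ℤ) : ℂ) * (((j k : Fin m) : ℕ) : ℂ) / m)).re :=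
        (Complex.re_sum _ _).symm
    _ = (∏ k : Fin 3, ∑ t : Fin m, Complex.exp (2 * Real.pi * Complex.I *
          (((q k : ℕ) : ℤ) : ℂ) * ((t : ℕ) : ℂ) / m)).re := by
        rw [Fintype.prod_sum]
    _ = 0 := by rw [hprod, Complex.zero_re]

end Summit.AtomisticToContinuum.BoseEinsteinCondensation.Theorems
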